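import Literature.NumberTheory.Automorphic.Liu2021.AppendixC.RestOne
import Literature.NumberTheory.Automorphic.Liu2021.Prop46NonemptyOfCasselmanUniformizers
import HarnessLib

/-!
# The END binder `hObj` at the one-object rest `restOne`, from Casselman's theorem

Cell pub-hodgecm2 (COR-CM), CARRIERS-PLAN step S4 — junction file (theorems only; no definition, no named fact).  At the
one-object rest `restOne C φ ι hμ hw Car …` of `Liu2021/AppendixC/RestOne` (`Obj := PLift (Nonempty (Def45.CMDatum φ ι hμ hw Car))`),
a consumer's END binder `hObj : Nonempty (toThm418Data C (restOne …)).Obj` IS [Liu2021] Prop. 4.6 (1) «`𝒜(μ)` is nonempty»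
(`nonempty_obj_restOne_iff`).  THIS FILE supplies it in the S2 instantiation `φ := AlgHom.id ℚ E`, `ι := σ` (the pin),
`Car := Def45.Carriers.ofPolDR μ P`, for a CM field `E` Galois over `ℚ`, from:
* the CITE `h21 : shimura1998_thm21_4_casselman` ([Shimura1998] Thm. 21.4 = [Shimura1971ZetaCM] Thm. 6, «Casselman's theorem»,
  `ComplexMultiplication/CasselmanHeckeCharacterCMStructure`), and
* an inhabitant of the posited ⟨CARRIER⟩ `P` of the last two bullets `(λ_μ, r_μ)` of Def. 4.5 (2),
via `Def45.nonempty_cmDatum_of_casselman'` (`Liu2021/Prop46NonemptyOfCasselmanUniformizers`, where all of (19.10a, b) for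
`χ = μ^{alg}` is proved).  HONEST SCOPE: nothing about `Ω(μ)`'s Hecke action `rhoΩ`, Liu's `X_K`/`A_K`, or HC_CM.

## References
* [Liu2021] Y. Liu, Camb. J. Math. 9 (2021) = arXiv:2102.11518 — Prop. 4.6 (1) (FJcycle.tex l. 1969; proof ll. 1975–1984),
  Thm. 4.18 (proof, l. 2232).
* [Shimura1998] G. Shimura, *Abelian Varieties with Complex Multiplication and Modular Functions* (1998), §21.4 Thm. 21.4.
-/

set_option autoImplicit false

noncomputable section

open NumberField
open Literature.AlgebraicGeometry.Motives
open Literature.NumberTheory.ComplexMultiplication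
open Literature.NumberTheory.Automorphic.Liu2021.AppendixC
open Literature.NumberTheory.Automorphic.Liu2021.AppendixC.RestOne

namespace Literature.NumberTheory.Automorphic.Liu2021.Def45

section ObjOne

variable {E : Type} [Field E] [NumberField E] [IsCMField E] [IsGalois ℚ E] (σ : E →+* ℂ)
  {μ : IdeleClassGroup E →ₜ* Circle} (hμ : IdeleClassGroup.IsConjugateSymplectic E μ)
  (hw : IdeleClassGroup.HasWeight E μ 1)

/-- **The one-object index is inhabited**: `ObjOne (AlgHom.id ℚ E) σ hμ hw (Carriers.ofPolDR μ P)` — [Liu2021] Prop. 4.6 (1)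
«`𝒜(μ)` is nonempty» at the pin `σ` — from Casselman's theorem `h21` and an inhabitant of the posited `(λ_μ, r_μ)`-carrier `P`.
[cite: Liu2021, Prop. 4.6 (1) (TeX l. 1969)] [cite: Shimura1998, §21.4 Thm. 21.4] -/
theorem nonempty_objOne_of_casselman (h21 : shimura1998_thm21_4_casselman)
    (P : ∀ A : AbelianVariety E, (IdeleClassGroup.muAlgValueField E μ →+* A.endAlgebra) → Type)
    (hP : ∀ A i, Nonempty (P A i)) :
    Nonempty (ObjOne (AlgHom.id ℚ E) σ hμ hw (Carriers.ofPolDR μ P)) :=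
  (nonempty_objOne_iff (AlgHom.id ℚ E) σ hμ hw (Carriers.ofPolDR μ P)).2 (nonempty_cmDatum_of_casselman' σ hμ hw h21 P hP)

end ObjOne

section RestOne

variable {F E : Type} [Field F] [NumberField F] [IsTotallyReal F] [Field E] [NumberField E] [Algebra F E]
  [IsTotallyComplex E] [Algebra.IsQuadraticExtension F E] [IsCMField E] [IsGalois ℚ E]
  {P5 : PropC5Data F E} {isotropicAt : ℕ → Prop} (C : Sec42Data P5 isotropicAt) (σ : E →+* ℂ)
  {μ : IdeleClassGroup E →ₜ* Circle} (hμ : IdeleClassGroup.IsConjugateSymplectic E μ)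
  (hw : IdeleClassGroup.HasWeight E μ 1)

/-- **The END binder `hObj` at `restOne`, from Casselman's theorem**: for the one-object rest over the Appendix-C datum `C` in the
S2 instantiation (`φ := id`, `ι := σ`, `Car := Carriers.ofPolDR μ P`), `Nonempty (toThm418Data C (restOne …)).Obj` holds GIVEN the
cite `h21` and an inhabitant of `P` — `nonempty_obj_restOne_iff` with `nonempty_cmDatum_of_casselman'`.
[cite: Liu2021, Prop. 4.6 (1) (TeX l. 1969) and Thm. 4.18 (proof, l. 2232)] [cite: Shimura1998, §21.4 Thm. 21.4] -/
theorem nonempty_obj_restOne_of_casselman (h21 : shimura1998_thm21_4_casselman)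
    (P : ∀ A : AbelianVariety E, (IdeleClassGroup.muAlgValueField E μ →+* A.endAlgebra) → Type)
    (hP : ∀ A i, Nonempty (P A i))
    (Eps : Type) (epsOf : E → Eps) (Chi : Type) (omega : Eps → Chi → Type)
    [∀ ε χ, AddCommGroup (omega ε χ)] [∀ ε χ, Module ℂ (omega ε χ)] (rho : ∀ ε χ, Representation ℂ C.G (omega ε χ))
    (rhoΩ : Representation (fieldOfValues E μ) C.G (ΩOne C (AlgHom.id ℚ E) σ hμ hw (Carriers.ofPolDR μ P))) :
    Nonempty (toThm418Data C
      (restOne C (AlgHom.id ℚ E) σ hμ hw (Carriers.ofPolDR μ P) Eps epsOf Chi omega rho rhoΩ)).Obj :=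
  (nonempty_obj_restOne_iff C (AlgHom.id ℚ E) σ hμ hw (Carriers.ofPolDR μ P) Eps epsOf Chi omega rho rhoΩ).2
    (nonempty_cmDatum_of_casselman' σ hμ hw h21 P hP)

end RestOne

end Literature.NumberTheory.Automorphic.Liu2021.Def45

end
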